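import Summits.QuantumFields.YangMills.Theorems.SwapVirialDeficitZeroModeExactPairLaplace
import HarnessLib

/-!
# Zero-mode EXACT rung Z2: the semicircle law of the real part — `Haar{u | x ≤ re q u} = (arccos x − x√(1−x²))/π` — and `Fin 2` adapters
# (free-hands support of crux ⟨stmt-QuantumFields-24197⟩ `SwapVirialDeficit.SwapGluedStiffness`; item Z2 of fcl-p3 g43's zero-mode exact rung plan
# `memo-24197-zero-mode-exact-rung.md`: «the tree has only the small-ball BOUNDS ✓`le_haarProbability_su2_two_sub_trace_le` /
# ✓`haarProbability_su2_two_sub_trace_lt_le`» — here is the EXACT distribution function)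

★★ `haar_re_ge_eq`: for `0 < x ≤ 1`, `Haar{u ∈ SU(2) | x ≤ re(q u)} = (arccos x − x·√(1−x²))/π` — with `x = cos φ` this is `(φ − sin φ cos φ)/π =
(2/π)∫₀^φ sin²`, the SEMICIRCLE (Sato–Tate) law of `re q u = ½ tr u`.  Proof: in the gnomonic chart `re(q(P(1,v))) = (1+|v|²)^{−1/2}`, so the cap is the
chart ball `|v|² ≤ (1−x²)/x²` (the lower hemisphere does not contribute), whose mass is `(2/π)∫₀^R r²(1+r²)⁻² dr = (arctan R − R/(1+R²))/π`, and
`arctan(√(1−x²)/x) = arccos x` (✓`Real.arccos_eq_arctan`).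
§19 restates the pair laws of files Z3/Z3-L (`Haar.prod Haar`, `p.1, p.2`) in the cell's `Measure.pi (fun _ : Fin 2 => Haar)` / `C 0, C 1` convention
(✓`measurePreserving_finTwoArrow`): `pi_pair_commBall_eq_prod`, ★★ `abs_pi_pair_commBall_sub_le`, ★★ `tendsto_pi_pair_laplace`.

HONEST LABEL: exact finite-dimensional Haar identities (plan-level zero-mode rung Z2 of a DRAFT line); NOT the fixed-`L` sharp law, NOT ⟨24197⟩; no rung /
summit statement is proved; the Yang–Mills mass gap is NOT proved; no summit is proved by a line.  Width seat ym-line-sfw-p2-w3 g62 (cell ym-idea-1,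
free hands; own crux ⟨22884⟩ blocked-on ⟨19935⟩), `--supports stmt-QuantumFields-24197`.  THEOREMS ONLY, standard axioms, 0 `sorry`.
References: [cite: Chatterjee2026YMHiggs, Lemma 5.1 / Cor. 5.2]; [folklore] (Sato–Tate / semicircle law on `SU(2)`).
-/

set_option autoImplicit false

noncomputable section

open MeasureTheory Quaternion Set Real Filter
open scoped Quaternion ENNReal BigOperators Topology
open Literature.MathematicalPhysics.QuantumLattice
open Literature.MathematicalPhysics.QuantumFieldTheory (haarProbability)
open Literature.MathematicalPhysics.QuantumFieldTheory.Balaban1983to89.T4HaarSU2Translate (su2Quat_quatToSU2 measurable_su2Quat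
  continuous_su2Quat)
open Summit.QuantumFields.YangMills.Theorems.SwapTwistDeficit.ToronLog

attribute [local instance] Literature.Analysis.FluidPDE.Tao2016.quatMeasurableSpace
  Literature.Analysis.FluidPDE.Tao2016.quatBorelSpace
  Literature.MathematicalPhysics.QuantumLattice.secondCountableTopology_su2

namespace Summit.QuantumFields.YangMills.Theorems.SwapVirialDeficit.ZeroModeExact

/-! ## §17 The cap integral `∫₀^R r²(1+r²)⁻² dr = (arctan R − R/(1+R²))/2` -/

/-- `d/dr [(arctan r − r(1+r²)⁻¹)/2] = r²·((1+r²)⁻¹)²`. [folklore] -/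
theorem hasDerivAt_cap (r : ℝ) :
    HasDerivAt (fun y : ℝ => (Real.arctan y - y * (1 + y ^ 2)⁻¹) / 2) (r ^ 2 * ((1 + r ^ 2)⁻¹) ^ 2) r := by
  have hne : (1 + r ^ 2) ≠ 0 := by positivity
  have h1 : HasDerivAt (fun y : ℝ => 1 + y ^ 2) (2 * r) r := by
    simpa using (hasDerivAt_pow 2 r).const_add 1
  have h2 : HasDerivAt (fun y : ℝ => y * (1 + y ^ 2)⁻¹) (1 * (1 + r ^ 2)⁻¹ + r * (-(2 * r) / (1 + r ^ 2) ^ 2)) r :=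
    (hasDerivAt_id r).mul (h1.inv hne)
  have h3 := ((Real.hasDerivAt_arctan' r).sub h2).div_const 2
  refine h3.congr_deriv ?_
  field_simp
  ring

/-- `∫₀^R r²·((1+r²)⁻¹)² dr = (arctan R − R/(1+R²))/2`. [folklore] -/
theorem integral_cap (R : ℝ) :
    ∫ r in (0 : ℝ)..R, r ^ 2 * ((1 + r ^ 2)⁻¹) ^ 2 = (Real.arctan R - R * (1 + R ^ 2)⁻¹) / 2 := by
  have hcont : Continuous fun r : ℝ => r ^ 2 * ((1 + r ^ 2)⁻¹) ^ 2 := by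
    refine (continuous_pow 2).mul ((Continuous.inv₀ (by fun_prop) fun x => ?_).pow 2)
    positivity
  rw [intervalIntegral.integral_eq_sub_of_hasDerivAt (fun x _ => hasDerivAt_cap x) (hcont.intervalIntegrable _ _)]
  simp

/-- Lower-integral form with the cut-off `r² ≤ S` (`S ≥ 0`): `∫_{r>0} r²·𝟙{r² ≤ S}(1+r²)⁻² = (arctan √S − √S/(1+S))/2`. [folklore] -/
theorem lintegral_cap_cutoff {S : ℝ} (hS : 0 ≤ S) :
    ∫⁻ r in Ioi (0 : ℝ), ENNReal.ofReal (r ^ 2) * (Set.Iic S).indicator (fun s : ℝ => ENNReal.ofReal (((1 + s)⁻¹) ^ 2)) (r ^ 2) =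
      ENNReal.ofReal ((Real.arctan (Real.sqrt S) - Real.sqrt S * (1 + S)⁻¹) / 2) := by
  have hsqrt : Real.sqrt S ^ 2 = S := Real.sq_sqrt hS
  have hsplit : ∫⁻ r in Ioi (0 : ℝ), ENNReal.ofReal (r ^ 2) * (Set.Iic S).indicator (fun s : ℝ => ENNReal.ofReal (((1 + s)⁻¹) ^ 2)) (r ^ 2) =
      ∫⁻ r in Ioc (0 : ℝ) (Real.sqrt S), ENNReal.ofReal (r ^ 2 * ((1 + r ^ 2)⁻¹) ^ 2) := by
    rw [← lintegral_indicator measurableSet_Ioc, ← lintegral_indicator measurableSet_Ioi]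
    refine lintegral_congr fun r => ?_
    by_cases h1 : r ∈ Ioi (0 : ℝ)
    · rw [indicator_of_mem h1]
      have h1' : 0 < r := h1
      by_cases h2 : r ≤ Real.sqrt S
      · rw [indicator_of_mem (show r ∈ Ioc (0 : ℝ) (Real.sqrt S) from ⟨h1', h2⟩), indicator_of_mem, ← ENNReal.ofReal_mul (sq_nonneg _)]
        rw [Set.mem_Iic]
        calc r ^ 2 ≤ Real.sqrt S ^ 2 := pow_le_pow_left₀ h1'.le h2 2
          _ = S := hsqrt
      · rw [indicator_of_notMem (fun h : r ∈ Ioc (0 : ℝ) (Real.sqrt S) => h2 h.2), indicator_of_notMem, mul_zero]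
        rw [Set.mem_Iic]; intro h3; apply h2
        rw [← Real.sqrt_sq h1'.le]; exact Real.sqrt_le_sqrt h3
    · rw [indicator_of_notMem h1, indicator_of_notMem (fun h : r ∈ Ioc (0 : ℝ) (Real.sqrt S) => h1 h.1)]
  rw [hsplit]
  have hcont : Continuous fun r : ℝ => r ^ 2 * ((1 + r ^ 2)⁻¹) ^ 2 := by
    refine (continuous_pow 2).mul ((Continuous.inv₀ (by fun_prop) fun x => ?_).pow 2)
    positivity
  rw [← ofReal_integral_eq_lintegral_ofReal (hcont.integrableOn_Icc.mono_set Ioc_subset_Icc_self)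
    (Filter.Eventually.of_forall fun r => by positivity), ← intervalIntegral.integral_of_le (Real.sqrt_nonneg S), integral_cap, hsqrt]

/-! ## §18 ★★ The semicircle law -/

/-- The cap `{x ≤ re q u}` is measurable. [folklore] -/
theorem measurableSet_reCap (x : ℝ) : MeasurableSet {u : Matrix.specialUnitaryGroup (Fin 2) ℂ | x ≤ (su2Quat u).re} :=
  measurableSet_le measurable_const (Quaternion.continuous_re.comp continuous_su2Quat).measurable

/-- In the chart: `re q(P(1,v)) = (√(1+|v|²))⁻¹` and `re q(P(−(1,v))) = −(√(1+|v|²))⁻¹`. [folklore] -/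
theorem re_proj_gnomonic (v : Fin 3 → ℝ) (s : Bool) :
    (su2Quat (quatToSU2 (if s then gnomonicQuat v else -gnomonicQuat v))).re =
      (if s then (1 : ℝ) else -1) * (Real.sqrt (1 + ∑ i, v i ^ 2))⁻¹ := by
  have hx : (if s then gnomonicQuat v else -gnomonicQuat v) ≠ 0 := by
    cases s
    · simpa using neg_ne_zero.2 (gnomonicQuat_ne_zero v)
    · simpa using gnomonicQuat_ne_zero v
  have hn : ‖(if s then gnomonicQuat v else -gnomonicQuat v)‖ = Real.sqrt (1 + ∑ i, v i ^ 2) := by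
    have h2 : ‖(if s then gnomonicQuat v else -gnomonicQuat v)‖ ^ 2 = 1 + ∑ i, v i ^ 2 := by
      cases s
      · simp only [Bool.false_eq_true, ↓reduceIte, norm_neg]; exact sq_norm_gnomonicQuat v
      · simp only [↓reduceIte]; exact sq_norm_gnomonicQuat v
    rw [← h2, Real.sqrt_sq (norm_nonneg _)]
  rw [su2Quat_quatToSU2 hx, Quaternion.re_smul, smul_eq_mul, hn]
  cases s <;> simp [gnomonicQuat]

/-- ★★ **THE SEMICIRCLE LAW OF THE REAL PART**: for `0 < x ≤ 1`, `Haar{u ∈ SU(2) | x ≤ re(q u)} = (arccos x − x·√(1−x²))/π`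
(as an extended real). [folklore] -/
theorem haar_re_ge_eq_ofReal {x : ℝ} (hx : 0 < x) (hx1 : x ≤ 1) :
    haarProbability (Matrix.specialUnitaryGroup (Fin 2) ℂ) {u : Matrix.specialUnitaryGroup (Fin 2) ℂ | x ≤ (su2Quat u).re} =
      ENNReal.ofReal ((Real.arccos x - x * Real.sqrt (1 - x ^ 2)) / Real.pi) := by
  set T := {u : Matrix.specialUnitaryGroup (Fin 2) ℂ | x ≤ (su2Quat u).re} with hT
  set S : ℝ := (1 - x ^ 2) / x ^ 2 with hSdef
  have hS : 0 ≤ S := by rw [hSdef]; exact div_nonneg (by nlinarith) (sq_nonneg _)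
  have hmeas : Measurable (T.indicator (1 : Matrix.specialUnitaryGroup (Fin 2) ℂ → ℝ≥0∞)) :=
    measurable_one.indicator (measurableSet_reCap x)
  rw [← lintegral_indicator_one (measurableSet_reCap x), lintegral_haarProbability_su2_gnomonic _ hmeas]
  -- pointwise: only the upper chart point can lie in the cap, and it does iff `|v|² ≤ S`
  have hpt : ∀ v : Fin 3 → ℝ, (T.indicator (1 : Matrix.specialUnitaryGroup (Fin 2) ℂ → ℝ≥0∞) (quatToSU2 (gnomonicQuat v)) +
      T.indicator (1 : Matrix.specialUnitaryGroup (Fin 2) ℂ → ℝ≥0∞) (quatToSU2 (-gnomonicQuat v))) *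
      ENNReal.ofReal (((1 + ∑ i, v i ^ 2)⁻¹) ^ 2) =
      (Set.Iic S).indicator (fun s : ℝ => ENNReal.ofReal (((1 + s)⁻¹) ^ 2)) (∑ i, v i ^ 2) := by
    intro v
    have hpos : 0 < 1 + ∑ i, v i ^ 2 := by positivity
    have hsq : 0 < Real.sqrt (1 + ∑ i, v i ^ 2) := Real.sqrt_pos.2 hpos
    have hp := re_proj_gnomonic v true
    have hm := re_proj_gnomonic v false
    simp only [↓reduceIte, Bool.false_eq_true, one_mul, neg_mul] at hp hm
    -- the lower point is never in the cap
    have hlow : quatToSU2 (-gnomonicQuat v) ∉ T := by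
      rw [hT, Set.mem_setOf_eq, hm, not_le]
      have : 0 < (Real.sqrt (1 + ∑ i, v i ^ 2))⁻¹ := inv_pos.2 hsq
      linarith
    -- the upper point: `x ≤ (√(1+Σ))⁻¹ ↔ Σ ≤ S`
    have hup : quatToSU2 (gnomonicQuat v) ∈ T ↔ ∑ i, v i ^ 2 ∈ Set.Iic S := by
      rw [hT, Set.mem_setOf_eq, hp, Set.mem_Iic, hSdef, le_div_iff₀ (by positivity : (0:ℝ) < x ^ 2), le_inv_comm₀ hx hsq,
        show x⁻¹ = Real.sqrt ((x ^ 2)⁻¹) by rw [Real.sqrt_inv, Real.sqrt_sq hx.le],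
        Real.sqrt_le_sqrt_iff (by positivity), ← one_div, le_div_iff₀ (by positivity : (0:ℝ) < x ^ 2)]
      constructor <;> intro h <;> nlinarith
    by_cases hv : ∑ i, v i ^ 2 ∈ Set.Iic S
    · rw [indicator_of_mem (hup.2 hv), indicator_of_notMem hlow, indicator_of_mem hv, Pi.one_apply, add_zero, one_mul]
    · rw [indicator_of_notMem (fun h => hv (hup.1 h)), indicator_of_notMem hlow, indicator_of_notMem hv, add_zero, zero_mul]
  simp_rw [hpt]
  have hmI : Measurable ((Set.Iic S).indicator (fun s : ℝ => ENNReal.ofReal (((1 + s)⁻¹) ^ 2))) :=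
    (ENNReal.measurable_ofReal.comp (by fun_prop)).indicator measurableSet_Iic
  rw [show (fun v : Fin 3 → ℝ => (Set.Iic S).indicator (fun s : ℝ => ENNReal.ofReal (((1 + s)⁻¹) ^ 2)) (∑ i, v i ^ 2)) =
      fun v => ((Set.Iic S).indicator (fun s : ℝ => ENNReal.ofReal (((1 + s)⁻¹) ^ 2))) (∑ i, v i ^ 2) from rfl,
    lintegral_chart_radial _ hmI, lintegral_cap_cutoff hS]
  -- `√S = √(1−x²)/x`, `arctan √S = arccos x`, `√S/(1+S) = x√(1−x²)`
  have hsqrtS : Real.sqrt S = Real.sqrt (1 - x ^ 2) / x := by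
    rw [hSdef, Real.sqrt_div (by nlinarith), Real.sqrt_sq hx.le]
  have harc : Real.arctan (Real.sqrt S) = Real.arccos x := by rw [hsqrtS, ← Real.arccos_eq_arctan hx]
  have h1S : 1 + S = (x ^ 2)⁻¹ := by rw [hSdef]; field_simp; ring
  have hfrac : Real.sqrt S * (1 + S)⁻¹ = x * Real.sqrt (1 - x ^ 2) := by
    rw [h1S, inv_inv, hsqrtS]; field_simp
  have hval : 0 ≤ Real.arccos x - x * Real.sqrt (1 - x ^ 2) := by
    rw [← hfrac, ← harc]
    -- `√S/(1+S) ≤ arctan √S` since `arctan y ≥ y/(1+y²)` for `y ≥ 0`: from the cap integral being nonnegative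
    have h := integral_cap (Real.sqrt S)
    have hnn : 0 ≤ ∫ r in (0 : ℝ)..Real.sqrt S, r ^ 2 * ((1 + r ^ 2)⁻¹) ^ 2 :=
      intervalIntegral.integral_nonneg (Real.sqrt_nonneg S) fun r _ => by positivity
    rw [h, Real.sq_sqrt hS] at hnn
    linarith
  rw [harc, hfrac, ← ENNReal.ofReal_mul (by positivity), ← ENNReal.ofReal_mul (by positivity)]
  congr 1
  field_simp
  ring

/-- ★★ **SEMICIRCLE LAW, real form**: `Haar.real{u | x ≤ re(q u)} = (arccos x − x√(1−x²))/π` for `0 < x ≤ 1`. [folklore] -/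
theorem haar_re_ge_eq {x : ℝ} (hx : 0 < x) (hx1 : x ≤ 1) :
    (haarProbability (Matrix.specialUnitaryGroup (Fin 2) ℂ)).real {u : Matrix.specialUnitaryGroup (Fin 2) ℂ | x ≤ (su2Quat u).re} =
      (Real.arccos x - x * Real.sqrt (1 - x ^ 2)) / Real.pi := by
  rw [measureReal_def, haar_re_ge_eq_ofReal hx hx1, ENNReal.toReal_ofReal]
  have h := (haarProbability (Matrix.specialUnitaryGroup (Fin 2) ℂ)).real {u : Matrix.specialUnitaryGroup (Fin 2) ℂ | x ≤ (su2Quat u).re}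
  -- nonnegativity: `x√(1−x²) ≤ arccos x` on `(0,1]`
  have h1 : x * Real.sqrt (1 - x ^ 2) ≤ Real.arccos x := by
    have hS : 0 ≤ (1 - x ^ 2) / x ^ 2 := div_nonneg (by nlinarith) (sq_nonneg _)
    have hI := integral_cap (Real.sqrt ((1 - x ^ 2) / x ^ 2))
    have hnn : 0 ≤ ∫ r in (0 : ℝ)..Real.sqrt ((1 - x ^ 2) / x ^ 2), r ^ 2 * ((1 + r ^ 2)⁻¹) ^ 2 :=
      intervalIntegral.integral_nonneg (Real.sqrt_nonneg _) fun r _ => by positivity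
    rw [hI, Real.sq_sqrt hS] at hnn
    have hsqrtS : Real.sqrt ((1 - x ^ 2) / x ^ 2) = Real.sqrt (1 - x ^ 2) / x := by
      rw [Real.sqrt_div (by nlinarith), Real.sqrt_sq hx.le]
    have harc : Real.arctan (Real.sqrt ((1 - x ^ 2) / x ^ 2)) = Real.arccos x := by rw [hsqrtS, ← Real.arccos_eq_arctan hx]
    have h1S : 1 + (1 - x ^ 2) / x ^ 2 = (x ^ 2)⁻¹ := by field_simp; ring
    have hfrac : Real.sqrt ((1 - x ^ 2) / x ^ 2) * (1 + (1 - x ^ 2) / x ^ 2)⁻¹ = x * Real.sqrt (1 - x ^ 2) := by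
      rw [h1S, inv_inv, hsqrtS]; field_simp
    rw [harc, hfrac] at hnn
    linarith
  exact div_nonneg (by linarith) Real.pi_pos.le

/-! ## §19 The pair laws in the `Fin 2 → SU(2)` / `Measure.pi` convention -/

/-- The pair commutator event: product form `=` pi form (✓`measurePreserving_finTwoArrow`). [folklore] -/
theorem pi_pair_commBall_eq_prod (t : ℝ) :
    (Measure.pi fun _ : Fin 2 => haarProbability (Matrix.specialUnitaryGroup (Fin 2) ℂ))
        {C : Fin 2 → Matrix.specialUnitaryGroup (Fin 2) ℂ | ‖su2Quat (C 0) * su2Quat (C 1) - su2Quat (C 1) * su2Quat (C 0)‖ ≤ t} =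
      ((haarProbability (Matrix.specialUnitaryGroup (Fin 2) ℂ)).prod (haarProbability (Matrix.specialUnitaryGroup (Fin 2) ℂ)))
        {p | ‖su2Quat p.1 * su2Quat p.2 - su2Quat p.2 * su2Quat p.1‖ ≤ t} := by
  have h := measurePreserving_finTwoArrow (haarProbability (Matrix.specialUnitaryGroup (Fin 2) ℂ))
  rw [← h.measure_preimage (measurableSet_pairBall t).nullMeasurableSet]
  rfl

/-- ★★ **Z3, pi form**: `|Haar²{C : Fin 2 → SU(2) | ‖[q(C 0), q(C 1)]‖ ≤ t} − t²/2| ≤ t³` for `0 ≤ t ≤ 1`. [folklore] -/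
theorem abs_pi_pair_commBall_sub_le {t : ℝ} (ht : 0 ≤ t) (ht1 : t ≤ 1) :
    |(Measure.pi fun _ : Fin 2 => haarProbability (Matrix.specialUnitaryGroup (Fin 2) ℂ)).real
        {C : Fin 2 → Matrix.specialUnitaryGroup (Fin 2) ℂ | ‖su2Quat (C 0) * su2Quat (C 1) - su2Quat (C 1) * su2Quat (C 0)‖ ≤ t}
        - t ^ 2 / 2| ≤ t ^ 3 := by
  rw [measureReal_def, pi_pair_commBall_eq_prod, ← measureReal_def]
  exact abs_haar_pair_commBall_sub_le ht ht1

/-- ★★ **Z3-L, pi form**: `β·∫ e^{−β‖[q(C 0), q(C 1)]‖²} dHaar²(C) → 1/2`. [folklore] -/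
theorem tendsto_pi_pair_laplace :
    Tendsto (fun β : ℝ => β * ∫ C : Fin 2 → Matrix.specialUnitaryGroup (Fin 2) ℂ,
        Real.exp (-(β * ‖su2Quat (C 0) * su2Quat (C 1) - su2Quat (C 1) * su2Quat (C 0)‖ ^ 2))
        ∂(Measure.pi fun _ : Fin 2 => haarProbability (Matrix.specialUnitaryGroup (Fin 2) ℂ))) atTop (𝓝 (1 / 2)) := by
  have h := measurePreserving_finTwoArrow (haarProbability (Matrix.specialUnitaryGroup (Fin 2) ℂ))
  have heq : ∀ β : ℝ, (∫ C : Fin 2 → Matrix.specialUnitaryGroup (Fin 2) ℂ,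
      Real.exp (-(β * ‖su2Quat (C 0) * su2Quat (C 1) - su2Quat (C 1) * su2Quat (C 0)‖ ^ 2))
      ∂(Measure.pi fun _ : Fin 2 => haarProbability (Matrix.specialUnitaryGroup (Fin 2) ℂ))) =
      ∫ p, Real.exp (-(β * ‖su2Quat p.1 * su2Quat p.2 - su2Quat p.2 * su2Quat p.1‖ ^ 2))
        ∂((haarProbability (Matrix.specialUnitaryGroup (Fin 2) ℂ)).prod (haarProbability (Matrix.specialUnitaryGroup (Fin 2) ℂ))) := by
    intro β
    rw [← h.integral_comp MeasurableEquiv.finTwoArrow.measurableEmbedding]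
    rfl
  simp_rw [heq]
  exact tendsto_pair_laplace

end Summit.QuantumFields.YangMills.Theorems.SwapVirialDeficit.ZeroModeExact

end
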